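import Literature.Analysis.FluidPDE.NSLerayHopfSereginStability
import Literature.Analysis.FluidPDE.JiaSverak2013Compactness
import Literature.Analysis.FluidPDE.RusinSverakSingularityStabilityEpsilon
import Literature.Analysis.FluidPDE.CKNOneScaleFromRRS
import HarnessLib

/-!
# The weak `L³` stability of local Leray solutions (`leray_solution_L3_weak_stability`) over the
live leaves of its decomposition

Analysis/FluidPDE proof file (no new definitions, no new named facts) for the named fact
`Literature.Analysis.FluidPDE.leray_solution_L3_weak_stability` (`NSLerayHopfSereginProfile.lean`;
Lemarié-Rieusset, *The Navier–Stokes Problem in the 21st Century* (2016), proof of Thm. 15.5,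
PDF pp. 570–573 of doi:10.1201/b19556 = Jia–Šverák 2013, proof of Thm. 1 with Lemmas 5–6, 8 and
Cor. 1: the weak `L³` compactness of local Leray solutions with the identification of the traces
and the stability of singular points, the input of Seregin's blow-up profile
`seregin_blowup_profile` ← `seregin_regular_of_liminf_L3` ← `seregin_L3_blowup_mild`).

State of the decomposition (accepted files): the fact ⇐ **K₃** ∧ **L** ∧ **B**
(`leray_solution_L3_weak_stability_of_compactness`, `NSLerayHopfSereginStability.lean`: the
`L³` compactness `jia_sverak_leray_weak_stability`, Rusin–Šverák's stability of singularities
`rusin_sverak_stability_of_singularities` and the backward-cylinder bridge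
`isRegularPoint_of_eLpNorm_parabolicCylinder_lt_top`); **K₃** ⇐ Jia–Šverák's Cor. 1, Lemma 8 and
the local Leray limiting procedure (`jia_sverak_leray_weak_stability_of_facts`,
`JiaSverak2013Compactness.lean`: the named facts `jia_sverak_2013_corollary_1`,
`jia_sverak_2013_lemma_8`, `localLeray_limiting_procedure`); **L**, **B** ⇐ the pressure decay
estimate — a theorem, `seregin_sverak_pressure_decay_holds` (`PressureDecayEstimateProofs.lean`) —
∧ the one-scale ε-regularity criterion `oneScaleRegularity`
(`rusin_sverak_stability_of_singularities_of_oneScaleRegularity`,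
`isRegularPoint_of_eLpNorm_parabolicCylinder_lt_top_of_oneScaleRegularity`,
`RusinSverakSingularityStabilityEpsilon.lean`), which follows from Robinson–Rodrigo–Sadowski's
Thm. 15.3 with force (`oneScaleRegularity_of_theorem15_3_force`, `CKNOneScaleFromRRS.lean`),
itself reduced to the named facts `RRS2016.step2_force`, `RRS2016.lemma15_12`
(`RRS2016.theorem15_3_force_of_step2`, `CKNLocalRegularityRRSStep3.lean`).

This file records the composites:

* `leray_solution_L3_weak_stability_of_oneScaleRegularity : jia_sverak_leray_weak_stability →
  oneScaleRegularity → leray_solution_L3_weak_stability`;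
* `leray_solution_L3_weak_stability_of_leaves : jia_sverak_2013_corollary_1 →
  jia_sverak_2013_lemma_8 → localLeray_limiting_procedure → RRS2016.step2_force →
  RRS2016.lemma15_12 → leray_solution_L3_weak_stability`,

so that the trust base of the fact is exactly these five printed results (Jia–Šverák 2013, Cor. 1
and Lemma 8; the local Leray limiting procedure of Lemarié-Rieusset / Kikuchi–Seregin /
Kang–Miura–Tsai; Robinson–Rodrigo–Sadowski 2016, Step 2 of the proof of Thm. 15.3 and
Lemma 15.12), each the target of an ongoing decomposition (the limiting procedure splits further
into Rusin–Šverák's Prop. 2.2 and the identification of the limit,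
`LocalLerayLimitingProcedure.lean`); `leray_solution_L3_weak_stability_holds` is their composition
with this theorem.

## References

* P. G. Lemarié-Rieusset, *The Navier–Stokes Problem in the 21st Century* (2016),
  doi:10.1201/b19556, proof of Thm. 15.5, PDF pp. 570–573, with Thm. 12.1, Thm. 14.4.
* H. Jia, V. Šverák, SIAM J. Math. Anal. 45 (2013) = arXiv:1201.1592, Cor. 1, Lemmas 5–8, proof
  of Thm. 1.
* W. Rusin, V. Šverák, J. Funct. Anal. 260 (2011) = arXiv:0911.0500, Lemma 2.1, Prop. 2.2.
* J. C. Robinson, J. L. Rodrigo, W. Sadowski, *The three-dimensional Navier–Stokes equations*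
  (2016), Thm. 15.3, Lemma 15.12, Cor. 15.6.
-/

noncomputable section

namespace Literature.Analysis.FluidPDE

/-- **The fact from K₃ and the one-scale criterion.** `leray_solution_L3_weak_stability` follows
from the `L³` compactness **K₃** `jia_sverak_leray_weak_stability` and `oneScaleRegularity`
(through **L** and **B**, the pressure decay estimate being a theorem).
[cite: LemarieRieusset2016, proof of Thm. 15.5, pp. 570–573, with Thm. 14.4] -/
theorem leray_solution_L3_weak_stability_of_oneScaleRegularity (hK : jia_sverak_leray_weak_stability)
    (hOS : oneScaleRegularity) : leray_solution_L3_weak_stability :=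
  leray_solution_L3_weak_stability_of_compactness hK
    (rusin_sverak_stability_of_singularities_of_oneScaleRegularity hOS)
    (isRegularPoint_of_eLpNorm_parabolicCylinder_lt_top_of_oneScaleRegularity hOS)

/-- **The fact over the live leaves.** `leray_solution_L3_weak_stability` (Lemarié-Rieusset 2016,
proof of Thm. 15.5, pp. 570–573) follows from Jia–Šverák's Cor. 1 and Lemma 8, the local Leray
limiting procedure, and the two remaining named facts of the Robinson–Rodrigo–Sadowski route to
the one-scale ε-regularity criterion: **K₃** by `jia_sverak_leray_weak_stability_of_facts`, the
ε-regularity input by `oneScaleRegularity_of_theorem15_3_force ∘ RRS2016.theorem15_3_force_of_step2`.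
[cite: LemarieRieusset2016, proof of Thm. 15.5, pp. 570–573, with Thm. 12.1 and Thm. 14.4] [cite: JiaSverak2013, proof of Thm. 1 with Cor. 1, Lemmas 5, 6, 8] -/
theorem leray_solution_L3_weak_stability_of_leaves (h1 : jia_sverak_2013_corollary_1)
    (h8 : jia_sverak_2013_lemma_8) (hlim : localLeray_limiting_procedure)
    (h2 : RRS2016.step2_force) (h12 : RRS2016.lemma15_12) : leray_solution_L3_weak_stability :=
  leray_solution_L3_weak_stability_of_oneScaleRegularity
    (jia_sverak_leray_weak_stability_of_facts h1 h8 hlim)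
    (oneScaleRegularity_of_theorem15_3_force (RRS2016.theorem15_3_force_of_step2 h2 h12))

end Literature.Analysis.FluidPDE

end
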